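import Mathlib
import Literature.MathematicalPhysics.QuantumFieldTheory.Balaban1983to89.Setup
import Literature.MathematicalPhysics.QuantumFieldTheory.Balaban1983to89.B11SectG

/-!
# `Balaban1983to89.B11AxialTransport190` — the Landau → axial transport of the decay (190) of
[Balaban1985Variational] Sect. G, which [Balaban1988Convergent] p. 251 consumes in the AXIAL gauge

CITATION HEADER (lean-in-tree rule 2026-08-18).  Sources, every quotation read from the page renders AS IMAGES by this
seat (2026-08-19): **B11** = T. Bałaban, *The variational problem and background fields in renormalization group method
for lattice gauge theories*, Commun. Math. Phys. **102**, 277–309 (1985), doi:10.1007/bf01229381 [Balaban1985Variational]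
(held `paper:balaban1985-cmp102-variational-background`; journal page = PDF page + 276; renders
`b2b-balaban-ref1/pages/1985-cmp102-variational-background/…-p004,p005,p029,p031,p032,p033-x2.png`): p. 280 [PDF 4]
(15)–(18), p. 281 [PDF 5] (19)–(21) + Prop. 2, p. 305 [PDF 29] Sect. G opening + (172)–(173), p. 307 [PDF 31] ll. 1–8 +
(181)–(182), p. 308 [PDF 32] (190), p. 309 [PDF 33] Prop. 9.  **B8** = T. Bałaban, *Spaces of regular gauge field
configurations on a lattice and gauge fixing conditions*, Commun. Math. Phys. **99**, 75–102 (1985) [Balaban1985RegularSpaces]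
(= ref. [6] of B11; renders `…1985-cmp99-regular-spaces-gauge-fixing-p004-x2.png` p. 78 (1.12)–(1.17) and `…-p005-x2.png`
p. 79 (1.19)–(1.20), Lemma 1 (1.24)–(1.25) and the sentence after (1.26), READ AS IMAGES; `…-p028-x2.png` p. 102, its
reference list).  **B7** = T. Bałaban, *Averaging operations for lattice gauge theories*, Commun. Math. Phys. **98**, 17–51
(1985), doi:10.1007/bf01211042 [Balaban1985Averaging] (= ref. [4] of B11 and ref. [3] of B8; renders
`…1985-cmp98-averaging-p013,p014,p015-x2.png` = pp. 29–31: (64)–(77), (78)–(87) and the locality sentence after (91), READ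
AS IMAGES by this seat for v2.2).  **B14** = T. Bałaban,
*Convergent renormalization expansions for lattice gauge theories*, Commun. Math. Phys. **119**, 243–285 (1988), doi:10.1007/bf01217741 [Balaban1988Convergent] (renders `…1988-cmp119-convergent-
renormalization-p006,p009,p027-x2.png`: p. 248 (1.12) + the axial gauge sentence, p. 251 (1.21) + the (190) sentence,
p. 269 (3.22)).  **B6** = [Balaban1984PropagatorsII] (2.54) (the triangle inequality of the multiscale distance d(y,y′),
sibling `…B6RandomWalk.Triangle254`; B11 p. 288 *"see [3] for a definition of the distance d(y, y′), y, y′ ∈ 𝔅_k"*).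
Sibling reuse: the `GaugeGroup` class of `…Setup` (its axiom `dist1_conj`; the h⁻¹gh form is the landed
`…B11GaugeGlue.dist1_conj_inv`, used here only inline so that this module's import cone stays `Setup` + `B11SectG`).

THE PRINTED SITUATION.  B14 p. 251, verbatim: *"where the function 𝐇_{1,Ax} depends on its argument restricted to a small
neighborhood of ∂Λ₁ (in fact one layer of M₁-cubes touching ∂Λ₁ and contained in Λ₁ᶜ). The dependence is analytic, and
the function 𝐇_{1,Ax} has the exponential decay property. It was formulated in (190) Sect. G of [15] for the Landau gauge,
but on the unit lattice it holds for any gauge, for which propagators are exponentially decaying, hence for the axial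
gauge too. … More precisely, we have |𝐇_{1,Ax}| < O(1)B₃ exp(−δMR₁)ε₁"*; the object is defined by (1.21) *"U₁ =
U₁(Ω₁∩Λ₁ᶜ, M˙(U₁)) = exp iL⁻¹𝐇_{1,Ax}(Ω₁∩Λ₁ᶜ, (1/i) log[M˙(U₁)(M˙(Q₁^{s*}V))⁻¹]) U₁(Ω₁∩Λ₁ᶜ, V)"* with both
minimal configurations in the axial gauge of p. 248 (*"the axial gauge conditions U(y, x) = 1 for x ∈ B(y), x ≠ y, y ∈
Ω₁^{(1)}. By Theorem 1 [15] there exists exactly one critical point of (1.12)"*).  B11 prints: Prop. 9 p. 309 *"The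
minimal configuration U_k(V) = U_k(V′V₀) in the axial gauge has an extension to an analytic function of Gᶜ-valued small
configurations V′ on 𝔅_k. … The function U_k(V′V₀)U_k(V₀)⁻¹ transformed to the Landau gauge is, by the definition,
equal to exp iη𝓗(B), where B = 1/i log V′. … and its functional derivative (182) satisfies the inequalities (190)"*;
p. 307 ll. 1–8 *"We make the gauge transformation inverse to the one applied previously, i.e. we transform the
configuration in the Landau gauge back to the axial gauge. This transformation is an analytic function of 𝓗, hence of
B, and we obtain a gauge field configuration in the axial gauge, which we denote also by U_k(V′V₀)"*; p. 280 (15)–(16)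
*"U = U′U₀, U′ = UU₀⁻¹. A gauge transformation u applied to U implements the following transformation of U′:
U′^u(x, x′) = u(x)U′(x, x′)R(U₀(x, x′))u⁻¹(x′), if U₀ is fixed in the representation (15)"*; p. 281 *"for an arbitrary
configuration U = U′U₀ from (18) there exists exactly one gauge transformation u satisfying R̄₀uʲ = 1 on Λ_j, j = 0,
1, …, k (thus u = 1 on Λ₀), such that U₁ = U′^{u⁻¹} satisfies the conditions (1.36)–(1.39) of [6]"* (= (19)–(21), the
Landau gauge R(U₀)D^{η*}_{U₀}A = 0); (190) p. 308 *"|δ𝓗_μ(B, x)/δB_ν(y′)|, … ≤ O(1)[(Lʲη)⁻¹, …]·(L^{j′}η)^{−d}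
exp(−⅛δ₀d(y, y′)) for x ∈ Δ(y), … y ∈ Λ_j, y′ ∈ Λ_{j′}"*.  B8 p. 79, the axial gauge Ax_k(𝔅_k, U₀) RELATIVE to U₀:
*"for x₀ ∈ Bʲ(x_j), x_j ∈ Λ_j, 1 ≤ j ≤ k, we define a sequence of points x₀, x₁, …, x_{j−1}, x_j by the conditions x_n ∈
B(x_{n+1}), n = 0, 1, …, j − 1, and we put (R̄ⁿ_{0,x_{n+1}}Ũ′ⁿ)(Γ_{x_{n+1},x_n}) = Π_{b⊂Γ_{x_{n+1},x_n}} R(Ū₀ⁿ(Γ_{x_{n+1},b₋}))Ũ′ⁿ_b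
= 1. (1.19) Let us recall that the average Ũ′ⁿ was defined in [3] as Ũ′ⁿ = (U′U₀)‾ⁿ(Ū₀ⁿ)⁻¹. (1.20) The conditions (1.19)
determine uniquely an element in each orbit given by the subgroup (1.14)"*, and (after (1.26)) *"The conditions
(R₀V′)(Γ_{y,x}) = 1, x ∈ B(y), imply V′_b = 1 for b ⊂ Γ_{y,x}"*.  So (1.19) is a HIERARCHY: its finest layer n = 0 (Ũ′⁰ =
U′) is bondwise U′ = 1 on the tree bonds inside the first-level blocks; its layers n ≥ 1 constrain the n-fold AVERAGES
(1.20) along Γ_{x_{n+1},x_n} ⊂ B^{n+1}(x_{n+1}).  B14 §1 is the ONE-LEVEL case (k = 1, U₀ = V₀ by B11 p. 280; B14 p. 248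
*"the axial gauge conditions U(y, x) = 1 for x ∈ B(y)"*), where the finest layer is the whole condition.

PRINT NOTES ADDED IN v2.2 (docstring-only).  (i) GLYPH [sic]: in the B8 p. 79 render the superscript of Ũ at BOTH (1.20)
loci — the prose *"the average Ũ…"* and the left side of the display — is one connected glyph reading «Ũᵐ», unlike the
separated «Ũ′ⁿ» of (1.19); it is normalised above to Ũ′ⁿ by (1.19) itself, by the exponents n on the right side of
(1.20), and by B8's *"[3]"* = B7, whose p. 29 prints (65) *"(Ũ′)_c = (U′U₀)‾_c(Ū₀)_c⁻¹"* and (69) *"Ũ′ʲ_b =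
(U′U₀)‾ʲ_b(Ū₀ʲ)_b⁻¹, b ⊂ Ω^{(j)}"* (cell GAPS C-adv2-60; crops `HOME/b2b-balaban-b11-g15/crops/b8-p79-*.png`).  Two
reference lists meet in this header: B8's [3] is B7 (= B11's [4]); B11's [3] — p. 288 above and the *"[3]"* of Parts
II–III below — is B6.  (ii) LOCATED IN PRINT, the solved form of the hierarchical axial conditions for the CONFIGURATION:
B7 pp. 29–31.  B7 p. 29 poses (64) *"(R_{0,y}U′)(Γ_{y,x}) = 1, x ∈ B(y), x ≠ y, y ∈ Ω^{(1)}"* and (67) *"(R̄ʲ_{0,y}Ũ′ʲ)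
(Γ_{y,x}) = 1, x ∈ B(y), x ≠ y, y ∈ Ω^{(j+1)}"* (= B8 (1.19)), then *"Now we would like to change these gauge conditions
and we apply a gauge transformation u⁻¹ to U′. We get some configuration U₁ and U′ = U₁^u. … The gauge conditions (67)
written in terms of U₁ give us the following equations: … (72) … Solving these equations, we get (R_{0,x₁}u)(x) =
u(x₁)(R_{0,x₁}U₁)(Γ_{x₁,x}) for x ∈ B(x₁), x₁ ∈ Ω^{(1)}, (73) … and for arbitrary j < k we have (R̄ʲ_{0,x_{j+1}}u)(x_j) =
u(x_{j+1})(R̄ʲ_{0,x_{j+1}}Ũ₁ʲ)(Γ_{x_{j+1},x_j}) for x_j ∈ B(x_{j+1}), x_{j+1} ∈ Ω^{(j+1)}. (76)"*; p. 30 composes these down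
the hierarchy x ∈ B(x₁), x₁ ∈ B(x₂), …: (77) *"R(U₀(Γ^{(j+1)}_{x_{j+1},x}))u(x) = … = u(x_{j+1})(R_{0,x_{j+1}}U₁)
(Γ^{(j+1)}_{x_{j+1},x}), x ∈ B^{j+1}(x_{j+1})"*, *"Taking (77) for j = k − 1, we may determine the gauge transformation u
uniquely, given values u(y) at points y of the lattice Ω^{(k)}"*, with the root normalisation (81) *"(R̄₀uᵏ)(y) = 1,
y ∈ Ω^{(k)}"* (B11 p. 281's *"R̄₀uʲ = 1"*) solved on p. 31 by (86)–(87) *"u(y) = (R̄_{0,y}U₁^{(k)})⁻¹"*, *"Thus the gauge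
transformation is uniquely determined by all the conditions and is given by the formulas (77) for j = k − 1 and by
(87)"*; and p. 31 prints the locality of the averages entering (87): *"these averages have the same locality properties
as the averages Ūᵏ, namely (Ūᵏ)_c, c ⊂ Ω^{(k)}, depends on the variables U_b for b ⊂ Bᵏ(c₋) ∪ Bᵏ(c₊)"*.  So
`transport_formula` (Part I) is (73) with the parallel transports R(U₀(Γ_{x₁,·})) (R(g)h = ghg⁻¹ as in (16)) and the
ordered product of (1.19) multiplied out into holonomies — on one bond Γ_{x₁,x} = ⟨x₁, x⟩, (73) reads U₀(x₁,x)u(x)U₀(x₁,x)⁻¹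
= u(x₁)U₁(x₁,x), which is `transport_step` — and the block-locality of U₁ ↦ u IS printed, for the configuration, as
(77) + (87); the averaged layers (74)–(77) and (87) stay untyped here (siblings touching these pages: `B7BlockAvgLog`
types the averaging (78)/(82) of gauge transformations; `B7Transfer` / `B7TransferLog` read (77) for one symbol,
DIVERGENCE D-pv14.8).  What has no printed sentence is only the DERIVATIVE-LEVEL consequence used on B14 p. 251 — that
𝓗 ↦ 𝐇_Ax therefore carries the (190) majorant (B14 argues instead *"for any gauge, for which propagators are
exponentially decaying"*; DIVERGENCE D-B11-23) — which is what Parts II–V type, hypotheses to conclusion.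

WHAT THIS MODULE KERNEL-CHECKS (the "one-line reduction axial ← Landau … written out" that cell GAPS G-B14s-02 asks for
and G-IF-08 names as option (b); nothing of B11/B14 is asserted — every printed statement enters as a hypothesis of the
printed SHAPE, and the conclusions are the bookkeeping a reader must supply):
(I) GAUGE ALGEBRA over `GaugeGroup` (pure group identities).  `relAct` = the relative action (16)/(1.17); `relAct_mul_bg`
((16) is the ordinary transform of U = U′U₀ with U₀ held fixed); `axialRatio_eq_relAct` (★: if the axial minimiser is
U^{ax}(V′V₀) = (e^{iη𝓗}U₀)^u — Prop. 2 read backwards — then the B14 object e^{iη𝐇_Ax} := U^{ax}(V′V₀)U^{ax}(V₀)⁻¹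
IS `relAct u e^{iη𝓗} U₀`); `dist1_relAct_le` (|e^{iη𝐇_Ax(b)} − 1| ≤ |u(b₋) − 1| + |e^{iη𝓗(b)} − 1| + |u(b₊) − 1|);
`transport_formula` (the finest layer of (1.19) — U′ = 1 bondwise along a tree path Γ, B8 after (1.26) — DETERMINES u
along Γ from u at the root and the variables of e^{iη𝓗}, U₀ ON Γ ONLY: u(γ_n) = Hol_{U₀}(γ|n)⁻¹·u(γ₀)·Hol_{e^{iη𝓗}U₀}(γ|n));
`transport_local` (hence two data agreeing on Γ and at the root give the same u on Γ — the BLOCK-LOCALITY of the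
Landau → axial map; for the CONFIGURATION this locality is printed, B7 (73)/(77) + (87) pp. 29–31, see PRINT NOTES (ii)
below (v2.2) — v1–v2.1 called it "the unprinted point", which is true only of its derivative-level use on B14 p. 251);
`dist1_transport_le` (|u(γ_n) − 1| ≤ |u(γ₀) − 1| + Σ_{b∈Γ|n}
|e^{iη𝓗(b)} − 1|).
(II) MAJORANT TRANSPORT over the sibling vocabulary `B11SectG.BlockNorm/HasMaj/Ineq190`: `ineq190_transport` — if δ𝓗/δB
has the (190)-majorant C·e^{−⅛δ₀d(y,y′)} (`Ineq190`, printed, hypothesis) and the linearised gauge map Φ = D(𝓗 ↦ 𝐇_Ax)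
has a ρ-LOCAL majorant (`localKernel ρ K`: K on d(y,y″) ≤ ρ, 0 beyond), then Φ∘δ𝓗/δB = δ𝐇_Ax/δB has the (190)-majorant
with the SAME rate ⅛δ₀ and the constant K·κ·C·N_ρ·e^{⅛δ₀ρ} (N_ρ = `NbhdCount`, the number of sites of 𝔅_k within
d-distance ρ) — the triangle inequality (2.54) [B6] is the only geometric input; `hasMaj_local_of_dep` — in the
sharp-block sup sizes a linear map whose value at x′ reads only a dependency set dep(x′) of ≤ m variables lying within
d-radius ρ, with Lipschitz constant K₀, HAS the ρ-local majorant K₀·m (this is what (I) delivers for the axial map: dep(b)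
= the block hierarchies of b₋, b₊, see below); `ineq190_axial_of_landau` = (II) assembled in that model.
(III) THE USE on B14 p. 251: `far_bound` / `far_bound_sum` — a (190)-majorant and a source B of block size ≤ m supported at
d-distance ≥ D from y give loc_y ≤ C·κ·c·m·e^{−δ₀D/16} with c the row sum of Lemma 2.1 [B6] at rate δ₀/16 (`RowSum`):
the shape of *"|𝐇_{1,Ax}| < O(1)B₃exp(−δMR₁)ε₁ … because the distance between □′ and the support of the argument is
greater than MR₁"* at the level of the linear response.
(IV) THE LOCALITY HYPOTHESIS MADE CONCRETE: `hasMaj_local_of_dep` (described under (II)) and `ineq190_axial_of_landau`.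
(V) THE MEAN-VALUE STEP `loc_sub_le_of_deriv` / `far_bound_meanValue` (sharp-block sup sizes on the target side): the
passage 𝐇_Ax(B) = ∫₀¹ D𝐇_Ax(tB)·B dt from the linear responses to the function — F(0) = 0, F′(s) = T_s B with every T_s
obeying (190) and B supported at d-distance ≥ D ⟹ loc_y F(1) ≤ C·κ·c·m·e^{−δ₀D/16}, the printed sentence's shape for
𝐇_{1,Ax} itself (one-variable mean value inequality coordinatewise).
WHAT IS *NOT* REPRODUCED OR ASSERTED: (190) itself (B11 Prop. 9; cell GAPS G-B11-G2/G2a for its own by-reference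
residues); the existence/uniqueness of u (B11 Prop. 2, printed theorem) and its analyticity in 𝓗 (B11 p. 307 ll. 1–8,
printed); the layers n ≥ 1 of (1.19) (conditions on the n-fold averages (1.20), fixing u at the level-n centres x_n ∈
B(x_{n+1}) from u(x_{n+1}) and the variables inside B^{n+1}(x_{n+1})) and the normalisation R̄₀uʲ = 1 fixing u at the roots
(B11 p. 281) — G-valued analytic equations LOCAL to the block hierarchy Bʲ(y) by their form (block averages of [B7] are
functions of the configuration on the block), recorded at read level in the companion record §3, not typed (absent in
B14 §1's one-level case except for the root normalisation) — their SOLVED form is printed, B7 (74)–(77) pp. 29–30 and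
(81)/(86)–(87) pp. 30–31 (PRINT NOTES (ii) above, v2.2): located, still not typed;
the value of ρ for B14's blocks in the d(y,y′) of [B6] (cell GAPS G-IF-06 owns the rate/metric reading); B14's
multi-domain minimisers (its §2) and the step-k object 𝐇^{(k)} of (3.22) p. 269 (cell GAPS G-B14s-08, consumer side).
Value = the transport lemma typed and kernel-checked with every constant explicit; NOT summit progress.  Unit
`b2b-balaban-b11-g14` (paper sub-cell B11, gen 14); companion record `HOME/b2b-balaban-b11-g14/AXIAL-TRANSPORT-190.md`,
cell rows GAPS C-B11-G14a/b (answer G-IF-08 (b) / G-B14s-02 from the B11 side), DIVERGENCE D-B11-23.  v2 = v1 p183661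
(commit 410a26887bec) + DOCFIX (B8 (1.19)–(1.20) quoted verbatim from the render read as an image; the finest layer of
(1.19), typed, distinguished from the averaged layers n ≥ 1, read level) + Part V APPENDED (the mean-value step, which
v1 recorded in prose only); the declarations of Parts I–IV are byte-identical to v1 (v2 = p183692 commit fa9adf214169;
v2.1 = comment-only: Part numbering V / (IV)–(V) made consistent; p183703 commit 064b7e9501ba).  v2.2 = DOCFIX,
docstring-only, every declaration byte-identical to v2.1: `far_bound_meanValue` now quotes B14 p. 251 *"for □′ ⊂ S₁"*
(v2–v2.1 had «𝔖′_j»; cell GAPS C-pv01-63 / C-ref2-41); `loc_sub_le_of_deriv` no longer sets the companion record's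
mean-value formula in quotation marks (C-pv01-63 R4); PRINT NOTES (i)–(ii) above (B8 (1.20) glyph, C-adv2-60; B7 pp.
29–31 located in print) and `transport_formula` re-tagged to B7 (73); unit `b2b-balaban-b11-g15` (gen 15).
-/

namespace Literature.MathematicalPhysics.QuantumFieldTheory.Balaban1983to89.B11AxialTransport190

open Literature.MathematicalPhysics.QuantumFieldTheory.Balaban1983to89
open Finset B6RandomWalk B11SectG

/-! ## Part I. Gauge algebra of the Landau → axial map ((15)–(16) p. 280, Prop. 2 p. 281, (1.19) [6]) -/

section GaugeAlgebra

variable {G : Type*} [GaugeGroup G] {X : Type*}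

/-- (16) p. 280 = (1.17) of [6] p. 78: with U = U′U₀ and U₀ FIXED, a gauge transformation u acts on the relative variable
by *"U′^u(x, x′) = u(x)U′(x, x′)R(U₀(x, x′))u⁻¹(x′)"*, R(U₀(x,x′))u⁻¹(x′) = U₀(x,x′)u(x′)⁻¹U₀(x,x′)⁻¹.
[cite: Balaban1985Variational, (16) p.280] -/
def relAct (u : X → G) (U' U₀ : X → X → G) (x y : X) : G :=
  u x * U' x y * (U₀ x y * (u y)⁻¹ * (U₀ x y)⁻¹)

/-- Unfolding of `relAct`. [folklore] -/
theorem relAct_apply (u : X → G) (U' U₀ : X → X → G) (x y : X) :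
    relAct u U' U₀ x y = u x * U' x y * (U₀ x y * (u y)⁻¹ * (U₀ x y)⁻¹) := rfl

/-- (16) IS the ordinary gauge transform of U = U′U₀ with U₀ kept fixed: U′^u·U₀ = u(x)·(U′U₀)(x,x′)·u(x′)⁻¹.
[cite: Balaban1985Variational, (15)–(16) p.280] -/
theorem relAct_mul_bg (u : X → G) (U' U₀ : X → X → G) (x y : X) :
    relAct u U' U₀ x y * U₀ x y = u x * (U' x y * U₀ x y) * (u y)⁻¹ := by
  simp only [relAct]; group

/-- The identity transformation acts trivially. [folklore] -/
theorem relAct_one (U' U₀ : X → X → G) : relAct (fun _ => (1 : G)) U' U₀ = U' := by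
  funext x y; simp [relAct]

/-- (16) is an action: (uv) acts as u after v. [folklore] -/
theorem relAct_mul (u v : X → G) (U' U₀ : X → X → G) :
    relAct (fun x => u x * v x) U' U₀ = relAct u (relAct v U' U₀) U₀ := by
  funext x y; simp only [relAct]; group

/-- ★ THE DICTIONARY LINE.  Prop. 2 p. 281 read backwards + Prop. 9 p. 309: the axial-gauge minimiser is U^{ax}(V′V₀)(b) =
u(b₋)·(e^{iη𝓗(B)}U₀)(b)·u(b₊)⁻¹ with U₀ = U_k(V₀) (axial) and u the unique gauge transformation of Prop. 2 for the pair;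
hence the object of B14 (1.21), e^{iη𝐇_Ax(B)}(b) := U^{ax}(V′V₀)(b)·U^{ax}(V₀)(b)⁻¹, is the (16)-transform of the Landau
ratio U₁ = e^{iη𝓗(B)}: e^{iη𝐇_Ax} = relAct u U₁ U₀.  (Hypothesis `hax` is the printed statement's shape; nothing asserted.)
[cite: Balaban1985Variational, Prop. 2 p.281 + Prop. 9 p.309; Balaban1988Convergent, (1.21) p.251] -/
theorem axialRatio_eq_relAct (u : X → G) (U₁ U₀ Uax : X → X → G)
    (hax : ∀ x y, Uax x y = u x * (U₁ x y * U₀ x y) * (u y)⁻¹) (x y : X) :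
    Uax x y * (U₀ x y)⁻¹ = relAct u U₁ U₀ x y := by
  rw [hax]; simp only [relAct]; group

/-- SIZE of the axial ratio: |e^{iη𝐇_Ax(b)} − 1| ≤ |u(b₋) − 1| + |e^{iη𝓗(b)} − 1| + |u(b₊) − 1| (dist1 = the invariant
size |· − 1| of `GaugeGroup`). [folklore] -/
theorem dist1_relAct_le (u : X → G) (U₁ U₀ : X → X → G) (x y : X) :
    dist1 (relAct u U₁ U₀ x y) ≤ dist1 (u x) + dist1 (U₁ x y) + dist1 (u y) := by
  have h3 : dist1 (U₀ x y * (u y)⁻¹ * (U₀ x y)⁻¹) = dist1 (u y) := by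
    rw [GaugeGroup.dist1_conj, GaugeGroup.dist1_inv]
  calc dist1 (relAct u U₁ U₀ x y)
      = dist1 (u x * U₁ x y * (U₀ x y * (u y)⁻¹ * (U₀ x y)⁻¹)) := rfl
    _ ≤ dist1 (u x * U₁ x y) + dist1 (U₀ x y * (u y)⁻¹ * (U₀ x y)⁻¹) := GaugeGroup.dist1_mul_le _ _
    _ ≤ dist1 (u x) + dist1 (U₁ x y) + dist1 (u y) := by
        rw [h3]; have h12 := GaugeGroup.dist1_mul_le (u x) (U₁ x y); linarith

/-- Ordered product (holonomy) of U along the first n bonds ⟨γ₀,γ₁⟩, …, ⟨γ_{n−1},γ_n⟩ of a lattice path γ (the contours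
Γ_{y,x} of the axial gauge, [6] (1.15)/(1.19), B14 (0.11) [I]). [folklore] -/
def holo (U : X → X → G) (γ : ℕ → X) : ℕ → G
  | 0 => 1
  | n + 1 => holo U γ n * U (γ n) (γ (n + 1))

/-- The empty holonomy is 1. [folklore] -/
@[simp] theorem holo_zero (U : X → X → G) (γ : ℕ → X) : holo U γ 0 = 1 := rfl

/-- One more bond. [folklore] -/
theorem holo_succ (U : X → X → G) (γ : ℕ → X) (n : ℕ) :
    holo U γ (n + 1) = holo U γ n * U (γ n) (γ (n + 1)) := rfl

/-- Holonomies along Γ read only the variables ON Γ. [folklore] -/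
theorem holo_congr (U U' : X → X → G) (γ : ℕ → X) {N : ℕ}
    (h : ∀ n < N, U (γ n) (γ (n + 1)) = U' (γ n) (γ (n + 1))) : ∀ n ≤ N, holo U γ n = holo U' γ n := by
  intro n hn
  induction n with
  | zero => rfl
  | succ n ih =>
      rw [holo_succ, holo_succ, ih (Nat.le_of_succ_le hn), h n (Nat.lt_of_succ_le hn)]

/-- The FINEST LAYER (n = 0, Ũ′⁰ = U′) of the relative axial gauge condition (1.19) of [6] along a path: U′(b) = 1 on
the first N bonds of γ — bondwise by the sentence printed after (1.26) of [6] (*"The conditions (R₀V′)(Γ_{y,x}) = 1,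
x ∈ B(y), imply V′_b = 1 for b ⊂ Γ_{y,x}"*); B14 p. 248 (one level): *"the axial gauge conditions U(y, x) = 1 for
x ∈ B(y)"*.  The layers n ≥ 1 of (1.19) (on the n-fold averages (1.20)) are NOT typed here.
[cite: Balaban1985RegularSpaces, (1.19) p.79] -/
def PathAxial (U' : X → X → G) (γ : ℕ → X) (N : ℕ) : Prop :=
  ∀ n < N, U' (γ n) (γ (n + 1)) = 1

/-- One step: the axial condition on the bond ⟨γ_n, γ_{n+1}⟩ for U′ = relAct u U₁ U₀ solves for u(γ_{n+1}).
[folklore] -/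
theorem transport_step (u : X → G) (U₁ U₀ : X → X → G) {x y : X} (h : relAct u U₁ U₀ x y = 1) :
    u y = (U₀ x y)⁻¹ * (u x * (U₁ x y * U₀ x y)) := by
  have h2 : U₀ x y * u y = u x * (U₁ x y * U₀ x y) := by
    calc U₀ x y * u y = relAct u U₁ U₀ x y * (U₀ x y * u y) := by rw [h, one_mul]
      _ = u x * (U₁ x y * U₀ x y) := by simp only [relAct]; group
  exact eq_inv_mul_of_mul_eq h2

/-- TRANSPORT FORMULA: if U′ = relAct u U₁ U₀ is axial along γ, then u on γ is DETERMINED by u at the root γ₀ and the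
variables of U₀ and U₁U₀ on γ: u(γ_n) = Hol_{U₀}(γ|n)⁻¹ · u(γ₀) · Hol_{U₁U₀}(γ|n).  This is [B7] (73) p. 29 *"Solving these
equations, we get (R_{0,x₁}u)(x) = u(x₁)(R_{0,x₁}U₁)(Γ_{x₁,x}) for x ∈ B(x₁), x₁ ∈ Ω^{(1)}"* with the parallel transports
R(U₀(Γ_{x₁,·})) and the ordered product of (1.19) [6] multiplied out into holonomies (LOCATED IN PRINT in v2.2; v1–v2.1
called it "the unprinted structural point behind B14's transfer" — unprinted is only its derivative-level use, header
PRINT NOTES (ii)). [cite: Balaban1985Averaging, (73) p.29] -/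
theorem transport_formula (u : X → G) (U₁ U₀ : X → X → G) (γ : ℕ → X) {N : ℕ}
    (h : PathAxial (relAct u U₁ U₀) γ N) :
    ∀ n ≤ N, u (γ n) = (holo U₀ γ n)⁻¹ * u (γ 0) * holo (fun x y => U₁ x y * U₀ x y) γ n := by
  intro n hn
  induction n with
  | zero => simp
  | succ n ih =>
      have hstep := transport_step u U₁ U₀ (h n (Nat.lt_of_succ_le hn))
      rw [hstep, ih (Nat.le_of_succ_le hn), holo_succ, holo_succ]
      group

/-- UNIQUENESS along the path: two transformations axialising the same (U₁, U₀) along γ and equal at the root agree on γ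
(the finest-layer half of [6] *"The conditions (1.19) determine uniquely an element in each orbit given by the
subgroup (1.14)"*).
[cite: Balaban1985RegularSpaces, (1.19) p.79] -/
theorem transport_unique (u u' : X → G) (U₁ U₀ : X → X → G) (γ : ℕ → X) {N : ℕ}
    (h : PathAxial (relAct u U₁ U₀) γ N) (h' : PathAxial (relAct u' U₁ U₀) γ N) (h0 : u (γ 0) = u' (γ 0)) :
    ∀ n ≤ N, u (γ n) = u' (γ n) := by
  intro n hn
  rw [transport_formula u U₁ U₀ γ h n hn, transport_formula u' U₁ U₀ γ h' n hn, h0]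

/-- LOCALITY (the point B14 p. 251 uses and nobody printed): if two Landau data (U₁, U₀), (U₁′, U₀′) AGREE ON THE PATH γ
and the axialising transformations agree at the root, they agree along γ — u(x) depends on 𝓗 = (1/iη) log U₁ only
through the bonds of Γ_{y,x} (and through u(y)). [folklore] -/
theorem transport_local (u u' : X → G) (U₁ U₀ U₁' U₀' : X → X → G) (γ : ℕ → X) {N : ℕ}
    (h : PathAxial (relAct u U₁ U₀) γ N) (h' : PathAxial (relAct u' U₁' U₀') γ N)
    (hU₁ : ∀ n < N, U₁ (γ n) (γ (n + 1)) = U₁' (γ n) (γ (n + 1)))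
    (hU₀ : ∀ n < N, U₀ (γ n) (γ (n + 1)) = U₀' (γ n) (γ (n + 1)))
    (h0 : u (γ 0) = u' (γ 0)) : ∀ n ≤ N, u (γ n) = u' (γ n) := by
  intro n hn
  have e₀ : holo U₀ γ n = holo U₀' γ n := holo_congr U₀ U₀' γ hU₀ n hn
  have e₁ : holo (fun x y => U₁ x y * U₀ x y) γ n = holo (fun x y => U₁' x y * U₀' x y) γ n :=
    holo_congr _ _ γ (fun m hm => by simp only [hU₁ m hm, hU₀ m hm]) n hn
  rw [transport_formula u U₁ U₀ γ h n hn, transport_formula u' U₁' U₀' γ h' n hn, h0, e₀, e₁]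

/-- The deviation of the two holonomies is controlled by the Landau variables on the path:
dist1(Hol_{U₀}(γ|n)⁻¹·Hol_{U₁U₀}(γ|n)) ≤ Σ_{i<n} dist1(U₁(γ_i, γ_{i+1})). [folklore] -/
theorem dist1_holo_dev_le (U₁ U₀ : X → X → G) (γ : ℕ → X) (n : ℕ) :
    dist1 ((holo U₀ γ n)⁻¹ * holo (fun x y => U₁ x y * U₀ x y) γ n) ≤
      ∑ i ∈ Finset.range n, dist1 (U₁ (γ i) (γ (i + 1))) := by
  have hconj : ∀ g h : G, dist1 (h⁻¹ * g * h) = dist1 g := fun g h => by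
    simpa using GaugeGroup.dist1_conj g h⁻¹
  induction n with
  | zero => simp [GaugeGroup.dist1_one]
  | succ n ih =>
      rw [Finset.sum_range_succ, holo_succ, holo_succ]
      set H₀ := holo U₀ γ n
      set H₁ := holo (fun x y => U₁ x y * U₀ x y) γ n
      set a := U₀ (γ n) (γ (n + 1))
      set b := U₁ (γ n) (γ (n + 1))
      have hsplit : (H₀ * a)⁻¹ * (H₁ * (b * a)) = (a⁻¹ * (H₀⁻¹ * H₁) * a) * (a⁻¹ * b * a) := by group
      rw [hsplit]
      calc dist1 ((a⁻¹ * (H₀⁻¹ * H₁) * a) * (a⁻¹ * b * a))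
          ≤ dist1 (a⁻¹ * (H₀⁻¹ * H₁) * a) + dist1 (a⁻¹ * b * a) := GaugeGroup.dist1_mul_le _ _
        _ = dist1 (H₀⁻¹ * H₁) + dist1 b := by rw [hconj, hconj]
        _ ≤ _ := by linarith [ih]

/-- QUANTITATIVE LOCALITY: along an axialised path, |u(γ_n) − 1| ≤ |u(γ₀) − 1| + Σ_{i<n} |U₁(γ_i,γ_{i+1}) − 1| — with
U₁ = e^{iη𝓗}, |U₁(b) − 1| ≲ η|𝓗(b)|, and path lengths ≤ d(L − 1) bonds per level this is the "u − 1 small, block by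
block" that makes the (1/iη) log chart of 𝐇_Ax legitimate (B11 p. 307: the back-transformation *"is an analytic function
of 𝓗"*). [folklore] -/
theorem dist1_transport_le (u : X → G) (U₁ U₀ : X → X → G) (γ : ℕ → X) {N : ℕ}
    (h : PathAxial (relAct u U₁ U₀) γ N) :
    ∀ n ≤ N, dist1 (u (γ n)) ≤ dist1 (u (γ 0)) + ∑ i ∈ Finset.range n, dist1 (U₁ (γ i) (γ (i + 1))) := by
  intro n hn
  have hconj : ∀ g h : G, dist1 (h⁻¹ * g * h) = dist1 g := fun g h => by
    simpa using GaugeGroup.dist1_conj g h⁻¹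
  rw [transport_formula u U₁ U₀ γ h n hn]
  set H₀ := holo U₀ γ n
  set H₁ := holo (fun x y => U₁ x y * U₀ x y) γ n
  have hsplit : H₀⁻¹ * u (γ 0) * H₁ = (H₀⁻¹ * u (γ 0) * H₀) * (H₀⁻¹ * H₁) := by group
  rw [hsplit]
  calc dist1 ((H₀⁻¹ * u (γ 0) * H₀) * (H₀⁻¹ * H₁))
      ≤ dist1 (H₀⁻¹ * u (γ 0) * H₀) + dist1 (H₀⁻¹ * H₁) := GaugeGroup.dist1_mul_le _ _
    _ = dist1 (u (γ 0)) + dist1 (H₀⁻¹ * H₁) := by rw [hconj]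
    _ ≤ _ := by
        have hdev : dist1 (H₀⁻¹ * H₁) ≤ ∑ i ∈ Finset.range n, dist1 (U₁ (γ i) (γ (i + 1))) :=
          dist1_holo_dev_le U₁ U₀ γ n
        linarith [hdev]

end GaugeAlgebra

/-! ## Part II. Transport of the (190)-majorant through a ρ-local linear map -/

section Transport

variable {g : B6.Geometry}
variable {FB FA FA' : Type} [AddCommGroup FB] [Module ℝ FB] [AddCommGroup FA] [Module ℝ FA]
  [AddCommGroup FA'] [Module ℝ FA']

/-- A ρ-LOCAL majorant: K on pairs with d(y, y″) ≤ ρ, 0 beyond — the shape of the linearised Landau → axial map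
𝓗 ↦ 𝐇_Ax (Part I: 𝐇_Ax near y reads 𝓗 only on the blocks/trees within d-radius ρ of y). [folklore] -/
noncomputable def localKernel (g : B6.Geometry) (ρ K : ℝ) : g.Site → g.Site → ℝ :=
  fun y y'' => if g.dist y y'' ≤ ρ then K else 0

/-- The local kernel is non-negative for K ≥ 0. [folklore] -/
theorem localKernel_nonneg {ρ K : ℝ} (hK : 0 ≤ K) (a b : g.Site) : 0 ≤ localKernel g ρ K a b := by
  unfold localKernel; split_ifs <;> simp [hK]

/-- N bounds the number of sites of 𝔅_k within d-distance ρ of any site (for the d(y,y′) of [3] and ρ = O(1) block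
diameters this is a constant depending on d, L only). [folklore] -/
def NbhdCount (g : B6.Geometry) (ρ N : ℝ) : Prop :=
  ∀ y : g.Site, (∑ y'' : g.Site, (if g.dist y y'' ≤ ρ then (1 : ℝ) else 0)) ≤ N

/-- A neighbourhood count is non-negative. [folklore] -/
theorem NbhdCount.nonneg {ρ N : ℝ} [Nonempty g.Site] (h : NbhdCount g ρ N) : 0 ≤ N := by
  obtain ⟨y⟩ := ‹Nonempty g.Site›
  exact le_trans (Finset.sum_nonneg fun y'' _ => by split_ifs <;> norm_num) (h y)

/-- THE TRANSPORT LEMMA.  If δ𝓗/δB has the printed (190)-majorant C·e^{−⅛δ₀d(y,y′)} (`Ineq190`, hypothesis of the printed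
shape) and the linearised gauge map Φ has a ρ-local majorant K, then Φ ∘ δ𝓗/δB (= δ𝐇_Ax/δB by the chain rule) has the
(190)-majorant with the SAME rate ⅛δ₀ and the constant K·κ·C·N·e^{⅛δ₀ρ}.  Inputs: the composition of majorants
(`B11SectG.hasMaj_comp`, [3] (2.52)–(2.55)) and the triangle inequality (2.54) of [3]: d(y″, y′) ≥ d(y, y′) − ρ on the
support of the local kernel. [cite: Balaban1985Variational, (190) p.308; Balaban1984PropagatorsII, (2.54) p.233] -/
theorem ineq190_transport {bB : BlockNorm g FB} {bA : BlockNorm g FA} {bA' : BlockNorm g FA'}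
    {dH : FB →ₗ[ℝ] FA} {Φ : FA →ₗ[ℝ] FA'} {C δ₀ ρ K N : ℝ}
    (htri : Triangle254 g) (h190 : Ineq190 bB bA dH C δ₀) (hΦ : HasMaj bA bA' Φ (localKernel g ρ K))
    (hN : NbhdCount g ρ N) (hK : 0 ≤ K) (hC : 0 ≤ C) (hδ : 0 ≤ δ₀) :
    Ineq190 bB bA' (Φ ∘ₗ dH) (K * bA.κ * C * N * Real.exp (δ₀ / 8 * ρ)) δ₀ := by
  unfold Ineq190 at h190 ⊢
  have hcomp := hasMaj_comp hΦ h190 (localKernel_nonneg hK)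
  refine hcomp.mono fun y y' => ?_
  set E : ℝ := K * bA.κ * C * Real.exp (δ₀ / 8 * ρ) * Real.exp (-(δ₀ / 8 * g.dist y y')) with hE
  have hκ := bA.κ_nonneg
  have hE0 : 0 ≤ E := by rw [hE]; positivity
  have hterm : ∀ y'' : g.Site,
      localKernel g ρ K y y'' * (bA.κ * (C * Real.exp (-(δ₀ / 8 * g.dist y'' y')))) ≤
        (if g.dist y y'' ≤ ρ then (1 : ℝ) else 0) * E := by
    intro y''
    unfold localKernel
    split_ifs with hρ
    · have htr : g.dist y y' ≤ ρ + g.dist y'' y' := (htri y y'' y').trans (by linarith)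
      have hexp : Real.exp (-(δ₀ / 8 * g.dist y'' y')) ≤
          Real.exp (δ₀ / 8 * ρ) * Real.exp (-(δ₀ / 8 * g.dist y y')) := by
        rw [← Real.exp_add]
        apply Real.exp_le_exp.mpr
        have hm := mul_le_mul_of_nonneg_left htr (by positivity : (0 : ℝ) ≤ δ₀ / 8)
        rw [mul_add] at hm
        linarith
      rw [one_mul, hE]
      calc K * (bA.κ * (C * Real.exp (-(δ₀ / 8 * g.dist y'' y'))))
          ≤ K * (bA.κ * (C * (Real.exp (δ₀ / 8 * ρ) * Real.exp (-(δ₀ / 8 * g.dist y y'))))) := by gcongr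
        _ = _ := by ring
    · simp
  calc ∑ y'' : g.Site, localKernel g ρ K y y'' * (bA.κ * (C * Real.exp (-(δ₀ / 8 * g.dist y'' y'))))
      ≤ ∑ y'' : g.Site, (if g.dist y y'' ≤ ρ then (1 : ℝ) else 0) * E :=
        Finset.sum_le_sum fun y'' _ => hterm y''
    _ = (∑ y'' : g.Site, (if g.dist y y'' ≤ ρ then (1 : ℝ) else 0)) * E := by rw [Finset.sum_mul]
    _ ≤ N * E := mul_le_mul_of_nonneg_right (hN y) hE0
    _ = K * bA.κ * C * N * Real.exp (δ₀ / 8 * ρ) * Real.exp (-(δ₀ / 8 * g.dist y y')) := by rw [hE]; ring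

/-! ## Part III. The far-field use (B14 p. 251 «the distance … is greater than MR₁») -/

/-- One localised source at distance ≥ D: loc_y(Tμ) ≤ C·e^{−⅛δ₀D}·loc_{y′}(μ). [cite: Balaban1985Variational, (190) p.308] -/
theorem far_bound {bB : BlockNorm g FB} {bA : BlockNorm g FA} {T : FB →ₗ[ℝ] FA} {C δ₀ D : ℝ}
    (h190 : Ineq190 bB bA T C δ₀) (hC : 0 ≤ C) (hδ : 0 ≤ δ₀) {y y' : g.Site} {μ : FB}
    (hμ : bB.IsLoc y' μ) (hD : D ≤ g.dist y y') :
    bA.loc y (T μ) ≤ C * Real.exp (-(δ₀ / 8 * D)) * bB.loc y' μ := by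
  have h := h190 y' μ hμ y
  refine h.trans (mul_le_mul_of_nonneg_right ?_ (bB.loc_nonneg _ _))
  refine mul_le_mul_of_nonneg_left (Real.exp_le_exp.mpr ?_) hC
  have := mul_le_mul_of_nonneg_left hD (by positivity : (0 : ℝ) ≤ δ₀ / 8)
  linarith

/-- A general source f whose blocks of non-zero size all lie at d-distance ≥ D from y, each of size ≤ m: loc_y(Tf) ≤
C·κ·c·m·e^{−δ₀D/16}, c = the row sum of Lemma 2.1 [3] at the rate δ₀/16 (half of the decay pays the distance, half pays
the sum over the support — the usual split).  This is the linear-response form of B14 p. 251 *"|𝐇_{1,Ax}| <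
O(1)B₃exp(−δMR₁)ε₁"*. [cite: Balaban1988Convergent, p.251; Balaban1984PropagatorsII, Lemma 2.1 (2.61) p.234] -/
theorem far_bound_sum {bB : BlockNorm g FB} {bA : BlockNorm g FA} {T : FB →ₗ[ℝ] FA} {C δ₀ D m c : ℝ}
    (h190 : Ineq190 bB bA T C δ₀) (hC : 0 ≤ C) (hδ : 0 ≤ δ₀) (hrow : RowSum g (δ₀ / 16) c)
    {y : g.Site} {f : FB} (hm : 0 ≤ m)
    (hfar : ∀ y' : g.Site, bB.loc y' f ≠ 0 → D ≤ g.dist y y')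
    (hsize : ∀ y' : g.Site, bB.loc y' f ≤ m) :
    bA.loc y (T f) ≤ C * bB.κ * c * m * Real.exp (-(δ₀ / 16 * D)) := by
  unfold Ineq190 at h190
  have hK : ∀ a b : g.Site, 0 ≤ C * Real.exp (-(δ₀ / 8 * g.dist a b)) := fun a b => by positivity
  have hb := h190.bound hK f y
  have hκ := bB.κ_nonneg
  set E : ℝ := C * bB.κ * m * Real.exp (-(δ₀ / 16 * D)) with hE
  have hE0 : 0 ≤ E := by rw [hE]; positivity
  have hterm : ∀ y' : g.Site, C * Real.exp (-(δ₀ / 8 * g.dist y y')) * (bB.κ * bB.loc y' f) ≤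
      E * Real.exp (-(δ₀ / 16 * g.dist y y')) := by
    intro y'
    by_cases h0 : bB.loc y' f = 0
    · rw [h0, mul_zero, mul_zero]; positivity
    · have hD := hfar y' h0
      have hsplit : Real.exp (-(δ₀ / 8 * g.dist y y')) =
          Real.exp (-(δ₀ / 16 * g.dist y y')) * Real.exp (-(δ₀ / 16 * g.dist y y')) := by
        rw [← Real.exp_add]; ring_nf
      have hexp : Real.exp (-(δ₀ / 16 * g.dist y y')) ≤ Real.exp (-(δ₀ / 16 * D)) := by
        apply Real.exp_le_exp.mpr
        have := mul_le_mul_of_nonneg_left hD (by positivity : (0 : ℝ) ≤ δ₀ / 16)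
        linarith
      calc C * Real.exp (-(δ₀ / 8 * g.dist y y')) * (bB.κ * bB.loc y' f)
          = C * (Real.exp (-(δ₀ / 16 * g.dist y y')) * Real.exp (-(δ₀ / 16 * g.dist y y'))) *
              (bB.κ * bB.loc y' f) := by rw [hsplit]
        _ ≤ C * (Real.exp (-(δ₀ / 16 * D)) * Real.exp (-(δ₀ / 16 * g.dist y y'))) * (bB.κ * m) := by
            gcongr
            · exact mul_nonneg hκ (bB.loc_nonneg _ _)
            · exact hsize y'
        _ = E * Real.exp (-(δ₀ / 16 * g.dist y y')) := by rw [hE]; ring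
  calc bA.loc y (T f)
      ≤ ∑ y' : g.Site, C * Real.exp (-(δ₀ / 8 * g.dist y y')) * (bB.κ * bB.loc y' f) := hb
    _ ≤ ∑ y' : g.Site, E * Real.exp (-(δ₀ / 16 * g.dist y y')) := Finset.sum_le_sum fun y' _ => hterm y'
    _ = E * ∑ y' : g.Site, Real.exp (-(δ₀ / 16 * g.dist y y')) := by rw [Finset.mul_sum]
    _ ≤ E * c := mul_le_mul_of_nonneg_left (hrow y) hE0
    _ = C * bB.κ * c * m * Real.exp (-(δ₀ / 16 * D)) := by rw [hE]; ring

end Transport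

/-! ## Part IV. The locality hypothesis made concrete (sharp blocks, finite dependency sets) -/

section Dependency

variable {g : B6.Geometry}

/-- In the sharp-block sup sizes (`BlockNorm.ofBlocks`): a linear map Φ whose value at x′ reads only the variables in a
dependency set dep(x′) of at most m elements, all carried by blocks within d-radius ρ of the block of x′, with Lipschitz
constant K₀, HAS the ρ-local majorant K₀·m.  For the linearised Landau → axial map this is Part I: dep(b) ⊆ the block
hierarchies Bʲ(y) ∋ b₋, b₊ — the bonds of the axial trees through b₋, b₊ (`transport_local`, finest layer of (1.19) [6])
together with the blocks carrying the averaged layers n ≥ 1 of (1.19) and the root normalisation R̄₀uʲ = 1 (B11 p. 281)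
— one j-block hierarchy each. [folklore] -/
theorem hasMaj_local_of_dep {X X' : Type} [Fintype X] [Fintype X'] (blk : X → g.Site) (blk' : X' → g.Site)
    (Φ : (X → ℝ) →ₗ[ℝ] (X' → ℝ)) (dep : X' → Finset X) {K₀ ρ : ℝ} {m : ℕ} (hK₀ : 0 ≤ K₀)
    (hdep : ∀ (x' : X') (f : X → ℝ), |Φ f x'| ≤ K₀ * ∑ x ∈ dep x', |f x|)
    (hρ : ∀ (x' : X'), ∀ x ∈ dep x', g.dist (blk' x') (blk x) ≤ ρ)
    (hm : ∀ x' : X', (dep x').card ≤ m) :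
    HasMaj (BlockNorm.ofBlocks g blk) (BlockNorm.ofBlocks g blk') Φ (localKernel g ρ (K₀ * m)) := by
  classical
  intro y' μ hμ y
  -- the source size
  set B : ℝ := (BlockNorm.ofBlocks g blk).loc y' μ with hB
  have hBdef : B = ⨆ x : X, if blk x = y' then |μ x| else 0 := rfl
  have hB0 : 0 ≤ B := (BlockNorm.ofBlocks g blk).loc_nonneg y' μ
  have hμle : ∀ x : X, |μ x| ≤ B := by
    intro x
    by_cases hx : blk x = y'
    · rw [hBdef]
      exact le_trans (by simp [hx]) (le_ciSup (Finite.bddAbove_range _) x)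
    · have : μ x = 0 := hμ x hx
      simp [this, hB0]
  have hloc : ∀ x : X, blk x ≠ y' → μ x = 0 := hμ
  -- pointwise bound at every x′ in the block of y
  have hpt : ∀ x' : X', blk' x' = y → |Φ μ x'| ≤ localKernel g ρ (K₀ * m) y y' * B := by
    intro x' hx'
    by_cases hex : ∃ x ∈ dep x', blk x = y'
    · obtain ⟨x₀, hx₀, hbx₀⟩ := hex
      have hd : g.dist y y' ≤ ρ := by rw [← hx', ← hbx₀]; exact hρ x' x₀ hx₀
      have hker : localKernel g ρ (K₀ * m) y y' = K₀ * m := by simp [localKernel, hd]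
      rw [hker]
      calc |Φ μ x'| ≤ K₀ * ∑ x ∈ dep x', |μ x| := hdep x' μ
        _ ≤ K₀ * ∑ x ∈ dep x', B := by gcongr with x hx; exact hμle x
        _ = K₀ * ((dep x').card * B) := by rw [Finset.sum_const, nsmul_eq_mul]
        _ ≤ K₀ * (m * B) := by gcongr; exact_mod_cast hm x'
        _ = K₀ * m * B := by ring
    · simp only [not_exists, not_and] at hex
      have hzero : ∑ x ∈ dep x', |μ x| = 0 :=
        Finset.sum_eq_zero fun x hx => by rw [hloc x (hex x hx), abs_zero]
      have h1 : |Φ μ x'| ≤ 0 := by simpa [hzero] using hdep x' μ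
      exact h1.trans (mul_nonneg (localKernel_nonneg (mul_nonneg hK₀ (Nat.cast_nonneg m)) _ _) hB0)
  -- assemble the sup over the block of y
  show (⨆ x' : X', if blk' x' = y then |Φ μ x'| else 0) ≤ localKernel g ρ (K₀ * m) y y' * B
  have hrhs : 0 ≤ localKernel g ρ (K₀ * m) y y' * B :=
    mul_nonneg (localKernel_nonneg (mul_nonneg hK₀ (Nat.cast_nonneg m)) _ _) hB0
  by_cases hX : Nonempty X'
  · refine ciSup_le fun x' => ?_
    split_ifs with hx'
    · exact hpt x' hx'
    · exact hrhs
  · rw [not_nonempty_iff] at hX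
    simp only [iSup_of_empty', Real.sSup_empty]
    exact hrhs

/-- ASSEMBLY in the sharp-block model: (190) for δ𝓗/δB into the sup sizes on the bonds X (hypothesis of the printed
shape) + a finite-dependency linearised axial map (Part I) ⇒ (190) for δ𝐇_Ax/δB with the same rate and the constant
K₀·m·C·N·e^{⅛δ₀ρ} (κ = 1 for sharp blocks).  This is G-IF-08 option (b) *"transport Landau → axial … preserves
exponential decay … up to a factor e^{O(δ)·(block diameter)}"* as a theorem over the printed leaves.
[cite: Balaban1985Variational, (190) p.308 + Prop. 9 p.309; Balaban1988Convergent, p.251] -/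
theorem ineq190_axial_of_landau {FB : Type} [AddCommGroup FB] [Module ℝ FB] {bB : BlockNorm g FB}
    {X X' : Type} [Fintype X] [Fintype X'] (blk : X → g.Site) (blk' : X' → g.Site)
    {dH : FB →ₗ[ℝ] (X → ℝ)} (Φ : (X → ℝ) →ₗ[ℝ] (X' → ℝ)) (dep : X' → Finset X)
    {C δ₀ ρ K₀ N : ℝ} {m : ℕ}
    (htri : Triangle254 g) (h190 : Ineq190 bB (BlockNorm.ofBlocks g blk) dH C δ₀)
    (hK₀ : 0 ≤ K₀) (hdep : ∀ (x' : X') (f : X → ℝ), |Φ f x'| ≤ K₀ * ∑ x ∈ dep x', |f x|)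
    (hρ : ∀ (x' : X'), ∀ x ∈ dep x', g.dist (blk' x') (blk x) ≤ ρ) (hm : ∀ x' : X', (dep x').card ≤ m)
    (hN : NbhdCount g ρ N) (hC : 0 ≤ C) (hδ : 0 ≤ δ₀) :
    Ineq190 bB (BlockNorm.ofBlocks g blk') (Φ ∘ₗ dH) (K₀ * m * C * N * Real.exp (δ₀ / 8 * ρ)) δ₀ := by
  have hΦ := hasMaj_local_of_dep blk blk' Φ dep hK₀ hdep hρ hm
  have h := ineq190_transport htri h190 hΦ hN (mul_nonneg hK₀ (Nat.cast_nonneg m)) hC hδ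
  have hκ : (BlockNorm.ofBlocks g blk).κ = 1 := rfl
  simpa [hκ] using h

end Dependency

/-! ## Part V. The mean-value step (B14 p. 251: from the linear response D𝐇_Ax to the function 𝐇_{1,Ax} itself) -/

section MeanValue

variable {g : B6.Geometry}
variable {FB : Type} [AddCommGroup FB] [Module ℝ FB]
variable {X' : Type} [Fintype X']

/-- |f(x′)| ≤ loc_y f for x′ in the (sharp) block of y. [folklore] -/
theorem abs_le_loc_ofBlocks (blk' : X' → g.Site) (f : X' → ℝ) {x' : X'} {y : g.Site} (hx : blk' x' = y) :
    |f x'| ≤ (BlockNorm.ofBlocks g blk').loc y f := by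
  classical
  show |f x'| ≤ ⨆ x : X', if blk' x = y then |f x| else 0
  exact le_trans (by simp [hx]) (le_ciSup (Finite.bddAbove_range _) x')

/-- loc_y f ≤ a as soon as |f(x′)| ≤ a on the block of y (and 0 ≤ a). [folklore] -/
theorem loc_ofBlocks_le (blk' : X' → g.Site) (f : X' → ℝ) {y : g.Site} {a : ℝ} (ha : 0 ≤ a)
    (h : ∀ x' : X', blk' x' = y → |f x'| ≤ a) : (BlockNorm.ofBlocks g blk').loc y f ≤ a := by
  classical
  show (⨆ x : X', if blk' x = y then |f x| else 0) ≤ a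
  refine Real.iSup_le (fun x' => ?_) ha
  split_ifs with hx'
  · exact h x' hx'
  · exact ha

/-- MEAN-VALUE STEP in the sharp-block sup sizes: a path s ↦ F(s) of lattice functions on [0, 1] (for B14 p. 251:
F(s) = 𝐇_Ax(sB)) with derivative F′(s) within [0, 1] whose size near y is ≤ R for every s ∈ [0, 1] satisfies
loc_y(F(1) − F(0)) ≤ R — the one-variable mean value inequality (`Convex.norm_image_sub_le_of_norm_hasDerivWithin_le`)
applied coordinatewise on the block of y.  This is the passage 𝐇_Ax(B) = ∫₀¹ D𝐇_Ax(tB)·B dt of the companion record §4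
(the record's formula, not a quotation from print), now typed.  The lineage's abstract version for an absolutely homogeneous, norm-dominated local size of any
`BlockNorm` is `B11HolderComplex.seminorm_image_sub_le_of_deriv_le_segment_01` (Hahn–Banach norming functional); the
sharp-block case is proved here directly, coordinatewise, so that this module keeps its two imports. [folklore] -/
theorem loc_sub_le_of_deriv (blk' : X' → g.Site) {F F' : ℝ → (X' → ℝ)} {y : g.Site} {R : ℝ}
    (hF : ∀ s ∈ Set.Icc (0 : ℝ) 1, HasDerivWithinAt F (F' s) (Set.Icc 0 1) s)
    (hR : ∀ s ∈ Set.Icc (0 : ℝ) 1, (BlockNorm.ofBlocks g blk').loc y (F' s) ≤ R) :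
    (BlockNorm.ofBlocks g blk').loc y (F 1 - F 0) ≤ R := by
  have h0 : (0 : ℝ) ∈ Set.Icc (0 : ℝ) 1 := ⟨le_rfl, zero_le_one⟩
  have h1 : (1 : ℝ) ∈ Set.Icc (0 : ℝ) 1 := ⟨zero_le_one, le_rfl⟩
  have hR0 : 0 ≤ R := le_trans ((BlockNorm.ofBlocks g blk').loc_nonneg y _) (hR 0 h0)
  refine loc_ofBlocks_le blk' _ hR0 fun x' hx' => ?_
  have hFx : ∀ s ∈ Set.Icc (0 : ℝ) 1, HasDerivWithinAt (fun s => F s x') (F' s x') (Set.Icc 0 1) s :=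
    fun s hs => (hasDerivWithinAt_pi.1 (hF s hs)) x'
  have hbound : ∀ s ∈ Set.Icc (0 : ℝ) 1, ‖F' s x'‖ ≤ R := fun s hs => by
    rw [Real.norm_eq_abs]
    exact (abs_le_loc_ofBlocks blk' (F' s) hx').trans (hR s hs)
  have hmv := Convex.norm_image_sub_le_of_norm_hasDerivWithin_le hFx hbound (convex_Icc 0 1) h0 h1
  rw [Real.norm_eq_abs, sub_zero, norm_one, mul_one] at hmv
  simpa [Pi.sub_apply] using hmv

/-- THE USE on B14 p. 251 for the function itself: with F(s) = 𝐇_Ax(sB) — F(0) = 0 because at B = 0 the two minimal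
configurations in (1.21) coincide (U = U₀, U′ = 1, U₁ = 1, u = 1 by the uniqueness in B11 Prop. 2 p. 281, so
e^{iη𝐇_Ax(0)} = 1: the companion record §2 (★)) — and F′(s) = D𝐇_Ax(sB)·B = T_s B, where every linear response T_s =
Φ_s ∘ δ𝓗/δB(sB) obeys (190) (hypothesis of the printed shape: B11 Prop. 9 states (190) for the functional derivative
(182) of the analytic function of all small B, p. 309, transported by Parts II–III at each s), a source B whose blocks
of non-zero size lie at d-distance ≥ D from y and have size ≤ m gives loc_y 𝐇_Ax(B) ≤ C·κ·c·m·e^{−δ₀D/16} — the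
printed *"This implies that the function 𝐇_{1,Ax} is very small on □′, for □′ ⊂ S₁, because the distance between
□′ and the support of the argument is greater than MR₁. More precisely, we have |𝐇_{1,Ax}| < O(1)B₃exp(−δMR₁)ε₁"*
(p. 251 [PDF 9]; S₁ of B14's own (1.20) on that page, *"S₁ = (Ω₁∖Ω₁^{~−1}) ∪ R₁"*; print sets the first H_{1,Ax} of
this sentence in italic lightface, the others bold — normalised; v2–v2.1 had misquoted «𝔖′_j» for S₁, cell GAPS
C-pv01-63) at the level of shapes; the identification of ρ, D = MR₁ and ε₁ with B14's blocks and sizes is the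
consumer's (cell GAPS G-IF-06 / G-B14s-08).  Companion of the NEAR-FIELD bound `B11HolderComplex.loc_le_of_ineq190_segment`
(all sizes of B ≤ s ⟹ loc_y 𝓗(B) ≤ C·κ·c·s, row sum at δ₀/8); here the support of B is far from y and half of the decay
rate pays for the distance. [cite: Balaban1988Convergent, p.251; Balaban1985Variational, Prop. 9 p.309] -/
theorem far_bound_meanValue (blk' : X' → g.Site) {bB : BlockNorm g FB} {T : ℝ → (FB →ₗ[ℝ] (X' → ℝ))}
    {F : ℝ → (X' → ℝ)} {B : FB} {C δ₀ D m c : ℝ} (hF0 : F 0 = 0)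
    (hF : ∀ s ∈ Set.Icc (0 : ℝ) 1, HasDerivWithinAt F (T s B) (Set.Icc 0 1) s)
    (h190 : ∀ s ∈ Set.Icc (0 : ℝ) 1, Ineq190 bB (BlockNorm.ofBlocks g blk') (T s) C δ₀)
    (hC : 0 ≤ C) (hδ : 0 ≤ δ₀) (hrow : RowSum g (δ₀ / 16) c) {y : g.Site} (hm : 0 ≤ m)
    (hfar : ∀ y' : g.Site, bB.loc y' B ≠ 0 → D ≤ g.dist y y') (hsize : ∀ y' : g.Site, bB.loc y' B ≤ m) :
    (BlockNorm.ofBlocks g blk').loc y (F 1) ≤ C * bB.κ * c * m * Real.exp (-(δ₀ / 16 * D)) := by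
  have h := loc_sub_le_of_deriv blk' (F' := fun s => T s B) hF
    (fun s hs => far_bound_sum (h190 s hs) hC hδ hrow hm hfar hsize)
  simpa [hF0] using h

end MeanValue

end Literature.MathematicalPhysics.QuantumFieldTheory.Balaban1983to89.B11AxialTransport190
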